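import Summits.CriticalPhenomena.PercolationContinuityZ3.Theorems.PercNearOneGluingNoHeavyQuantSDEC
import Summits.CriticalPhenomena.PercolationContinuityZ3.Theorems.PercNearOneGluingNoHeavyQuantFarTreeRowContraction
import HarnessLib

/-!
# QUANT lane R8 — the reached-relay count of every rooted forest (gate coordinates of `Quant.FarTreeRow`) is a TREE-BUILT law
# (`Quant.LawDec.TreeBuilt`, census-2 g53): the bookkeeping bridge between the geometric tree row and the law-level induction class

builds on p205010 (kernel theorem, internal audit signed; external expert review pending)

Support file (`--supports stmt-CriticalPhenomena-4575`), QUANT lane lead seat prim-quant-lead (gen 20), rung R8 of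
`run/shared/lean/prim/quant/LADDER.md`.  Theorems only, no definitions, no sorries, standard axioms.  Companion (next file):
`…QuantFarTreeRowOfTreeBuilt.lean` — `FAR for tree-built laws ⟹ Quant.FarTreeRow` and `LawDec.SDECConvClosed ⟹ Quant.FarTreeRow`.

WHY.  The R8 architecture of record (README V185; census-2 g49 ARCH-TREES-G49, g53 DEC-CLOSURE-G53) works at the level of COUNT LAWS:
`LawDec.TreeBuilt x M μ` (`…QuantSDEC`) is the closure of the empty law `δ₀` and the unit relay `δ₁` under independent sums (`lconv`),
Bernoulli gating (`gate`, floor `↦ q·x`) and floor-lowering, and census-2 g53 proved `SDECConvClosed → TreeBuilt x M μ → ∀ j′, DECAt x j′ M μ`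
(`LawDec.decAt_of_treeBuilt`), leaving "the count law in `Quant.FarTreeRow`'s binder is `TreeBuilt`" as bookkeeping for the typer/lead.
This file does that bookkeeping, so that every law-level theorem about tree-built laws transfers to `Quant.FarTreeRow` (and, by
`Quant.farRelayRow_tree_of_farTreeRow`, to `Quant.FarRelayRow` on tree-supported weights).

SETTING (that of `Quant.FarTreeRow`, index type `E`): independent gates `q : E → [0,1]` (`prodBernoulli q` on `Set E`), relays `A`,
ancestor finsets `P a`; `N_A(ω) = #{a ∈ A : P a ⊆ ω}`.  Only TRANSITIVITY (`y ∈ P x → P y ⊆ P x`) and COMPARABILITY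
(`y, z ∈ P x → y ∈ P z ∨ z ∈ P y`) of the ancestor finsets are used — not reflexivity — which makes "erase one gate from every
ancestor set" an admissible move and drives the induction.

* `LawDec.lconv_point_relay`, `LawDec.treeBuilt_point` — `δ_k ✱ δ₁ = δ_{k+1}`; point masses are tree-built.
* `ForestLaw.real_count_eq_point` / `real_count_eq_lconv` / `real_count_eq_gate` — the three law identities: no needed gate ⟹ `δ_{#A}`;
  relays needing a gate `r` vs the others, reading DISJOINT gates ⟹ the law is the `lconv` of the two laws (block independence,
  `prodBernoulli_real_inter_of_determinedBy_disjoint`); every relay needs `r` ⟹ the law is the `gate` by `q r` of the law with `r` erased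
  (conditioning on one gate, `Quant.prodBernoulli_real_gate_split`).
* `ForestLaw.exists_root`, `root_mem_of_mem`, `disjoint_biUnion_root` — a ROOT gate (needed, ancestor set of minimal size, self-rooted or
  free-standing) exists; needed gates inside its ancestor set are glued to it; hence the relays needing it and the others read disjoint gates.
* **`ForestLaw.treeBuilt_real_count` / `treeBuilt_law`** — for transitive comparable `P`, every `A`, every floor `0 < x < 1` with
  `x < ∏_{y ∈ P a} q y` on `A`: the law of `N_A` is `LawDec.TreeBuilt x #A`.  Induction on `#(⋃_A P a) + #A`: point / gate (erase the
  root, floor `x / q r`) / convolution (tree of the root ⊔ rest).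

[this work]; law-level class and closure conjecture: prim-quant-census-2 g53 (this lane); conditioning on an edge and block independence
[cite: Grimmett1999, §2.4; §2.2; §1.3 p. 10]; the gluing rows served [cite: KozmaNitzan2024, Conjecture 3 (p. 15)].
-/

noncomputable section

namespace Summit.CriticalPhenomena.PercolationContinuityZ3.Theorems

namespace Quant

namespace LawDec

open Finset

/-- `δ_k ✱ δ₁ = δ_{k+1}` for the indicator convolution `lconv`. [this work] -/
theorem lconv_point_relay (k : ℕ) :
    lconv k 1 (fun h => if h = k then (1 : ℝ) else 0) (fun h => if h = 1 then (1 : ℝ) else 0) =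
      fun h => if h = k + 1 then (1 : ℝ) else 0 := by
  funext h
  simp only [lconv]
  rw [Finset.sum_eq_single k]
  · rw [Finset.sum_eq_single 1]
    · simp only [if_true, mul_one]
      by_cases hh : h = k + 1
      · rw [if_pos hh, if_pos (by omega)]
      · rw [if_neg hh, if_neg (by omega)]
    · intro l hl hl1
      rw [Finset.mem_range] at hl
      have hl0 : l = 0 := by omega
      subst hl0
      simp
    · intro h1; exact absurd (Finset.mem_range.2 (by norm_num)) h1
  · intro i hi hik
    refine Finset.sum_eq_zero fun l _ => ?_
    rw [if_neg hik, zero_mul]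
    split_ifs <;> rfl
  · intro hk; exact absurd (Finset.mem_range.2 (Nat.lt_succ_self k)) hk

/-- **Point masses are tree-built**: `δ_k` is `TreeBuilt x k` at every floor `0 < x < 1` (`k` relays at a sure hub). [this work] -/
theorem treeBuilt_point (x : ℝ) (hx0 : 0 < x) (hx1 : x < 1) :
    ∀ k : ℕ, TreeBuilt x k (fun h => if h = k then (1 : ℝ) else 0)
  | 0 => TreeBuilt.nil x hx0 hx1
  | k + 1 => by
    have := TreeBuilt.conv (treeBuilt_point x hx0 hx1 k) (TreeBuilt.relay x hx0 hx1)
    rwa [lconv_point_relay k] at this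

end LawDec

namespace ForestLaw

open Finset MeasureTheory
open Literature.Probability.LatticeModels
open Literature.Probability.Percolation
open scoped Classical

variable {E : Type*} [Fintype E]

/-- the number of relays of `A` reached in `ω` (all ancestral gates `P a` open) -/
local notation3 "Nc[" A ", " P ", " ω "]" =>
  ((A : Finset E).filter fun a => (((P : E → Finset E) a : Finset E) : Set E) ⊆ (ω : Set E)).card

/-! ### 1. Three law identities in gate coordinates -/

omit [Fintype E] in
/-- The count of `A` is determined by the gates `⋃_{a ∈ A} P a`. [this work] -/
theorem count_congr_of_agree (A : Finset E) (P : E → Finset E) (ω ω' : Set E)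
    (h : ∀ y ∈ A.biUnion P, (y ∈ ω ↔ y ∈ ω')) : Nc[A, P, ω] = Nc[A, P, ω'] := by
  congr 1
  refine Finset.filter_congr fun a ha => ?_
  have hy : ∀ y ∈ P a, (y ∈ ω ↔ y ∈ ω') := fun y hy => h y (Finset.mem_biUnion.2 ⟨a, ha, hy⟩)
  constructor
  · intro hs y hy'; exact (hy y (Finset.mem_coe.1 hy')).1 (hs hy')
  · intro hs y hy'; exact (hy y (Finset.mem_coe.1 hy')).2 (hs hy')

omit [Fintype E] in
/-- The event `{N_A = h}` is determined by the gates `⋃_{a ∈ A} P a`. [this work] -/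
theorem determinedBy_count (A : Finset E) (P : E → Finset E) (h : ℕ) :
    DeterminedBy {ω : Set E | Nc[A, P, ω] = h} (↑(A.biUnion P) : Set E) := by
  rw [determinedBy_iff]
  intro ω ω' hagree
  simp only [Set.mem_setOf_eq]
  rw [count_congr_of_agree A P ω ω' fun y hy => ?_]
  constructor
  · intro hyω; exact ((Set.ext_iff.1 hagree y).1 ⟨hyω, Finset.mem_coe.2 hy⟩).1
  · intro hyω'; exact ((Set.ext_iff.1 hagree y).2 ⟨hyω', Finset.mem_coe.2 hy⟩).1

/-- **Convolution law.**  If the relays split as `A = A₁ ⊔ A₂` (those needing a gate `r`, those not) and the two parts read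
DISJOINT sets of gates, then the law of `N_A = N_{A₁} + N_{A₂}` is the convolution `lconv` of the two laws (block independence
under `prodBernoulli`). [this work] -/
theorem real_count_eq_lconv (q : E → unitInterval) (A : Finset E) (P : E → Finset E) (r : E)
    (hdisj : Disjoint ((A.filter fun a => r ∈ P a).biUnion P) ((A.filter fun a => ¬ r ∈ P a).biUnion P)) (h : ℕ) :
    (prodBernoulli q).real {ω : Set E | Nc[A, P, ω] = h} =
      LawDec.lconv (A.filter fun a => r ∈ P a).card (A.filter fun a => ¬ r ∈ P a).card
        (fun i => (prodBernoulli q).real {ω : Set E | Nc[A.filter (fun a => r ∈ P a), P, ω] = i})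
        (fun i => (prodBernoulli q).real {ω : Set E | Nc[A.filter (fun a => ¬ r ∈ P a), P, ω] = i}) h := by
  set A₁ := A.filter (fun a => r ∈ P a) with hA₁
  set A₂ := A.filter (fun a => ¬ r ∈ P a) with hA₂
  -- the count splits
  have hsplit : ∀ ω : Set E, Nc[A, P, ω] = Nc[A₁, P, ω] + Nc[A₂, P, ω] := by
    intro ω
    rw [hA₁, hA₂, Finset.filter_filter, Finset.filter_filter,
      ← Finset.card_union_of_disjoint (Finset.disjoint_filter.2 fun a _ h1 h2 => h2.1 h1.1)]
    congr 1
    ext a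
    simp only [Finset.mem_filter, Finset.mem_union]
    tauto
  -- the event as a disjoint union over the pairs of counts
  set I := (Finset.range (A₁.card + 1) ×ˢ Finset.range (A₂.card + 1)).filter (fun ik : ℕ × ℕ => ik.1 + ik.2 = h) with hI
  have hdec : {ω : Set E | Nc[A, P, ω] = h} = ⋃ ik ∈ I, ({ω : Set E | Nc[A₁, P, ω] = ik.1} ∩ {ω : Set E | Nc[A₂, P, ω] = ik.2}) := by
    ext ω
    simp only [Set.mem_setOf_eq, Set.mem_iUnion, Set.mem_inter_iff, hI, Finset.mem_filter, Finset.mem_product,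
      Finset.mem_range, exists_prop, Prod.exists]
    constructor
    · intro hω
      refine ⟨Nc[A₁, P, ω], Nc[A₂, P, ω], ⟨⟨Nat.lt_succ_of_le (Finset.card_filter_le _ _),
        Nat.lt_succ_of_le (Finset.card_filter_le _ _)⟩, ?_⟩, rfl, rfl⟩
      rw [← hsplit ω]; exact hω
    · rintro ⟨i, k, ⟨-, hik⟩, hi, hk⟩
      rw [hsplit ω, hi, hk]; exact hik
  have hpd : (I : Set (ℕ × ℕ)).PairwiseDisjoint
      (fun ik => {ω : Set E | Nc[A₁, P, ω] = ik.1} ∩ {ω : Set E | Nc[A₂, P, ω] = ik.2}) := by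
    intro ik _ ik' _ hne
    rw [Function.onFun, Set.disjoint_left]
    rintro ω ⟨h1, h2⟩ ⟨h1', h2'⟩
    simp only [Set.mem_setOf_eq] at h1 h2 h1' h2'
    exact hne (Prod.ext (h1.symm.trans h1') (h2.symm.trans h2'))
  rw [hdec, measureReal_biUnion_finset hpd (fun _ _ => MeasurableSet.of_discrete)]
  -- block independence, term by term
  have hterm : ∀ ik ∈ I, (prodBernoulli q).real ({ω : Set E | Nc[A₁, P, ω] = ik.1} ∩ {ω : Set E | Nc[A₂, P, ω] = ik.2}) =
      (prodBernoulli q).real {ω : Set E | Nc[A₁, P, ω] = ik.1} * (prodBernoulli q).real {ω : Set E | Nc[A₂, P, ω] = ik.2} :=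
    fun ik _ => prodBernoulli_real_inter_of_determinedBy_disjoint q hdisj (determinedBy_count A₁ P ik.1)
      (determinedBy_count A₂ P ik.2) MeasurableSet.of_discrete MeasurableSet.of_discrete
  rw [Finset.sum_congr rfl hterm, hI, Finset.sum_filter, Finset.sum_product]
  rfl

/-- **Gate law.**  If every relay of `A` needs the gate `r`, then the law of `N_A` is the law of the count with `r` ERASED from every
ancestor set, gated by `q r`: `P(N = h) = q r · P(N′ = h) + (1 − q r)·[h = 0]` (conditioning on the state of `r`). [this work] -/
theorem real_count_eq_gate (q : E → unitInterval) (A : Finset E) (P : E → Finset E) (r : E) (hr : ∀ a ∈ A, r ∈ P a) (h : ℕ) :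
    (prodBernoulli q).real {ω : Set E | Nc[A, P, ω] = h} =
      LawDec.gate (fun i => (prodBernoulli q).real {ω : Set E | Nc[A, (fun y => (P y).erase r), ω] = i}) (q r) h := by
  have hdet : DeterminedBy {ω : Set E | Nc[A, P, ω] = h} (↑(Finset.univ : Finset E) : Set E) := by
    rw [determinedBy_iff]
    intro ω ω' e
    simp only [Finset.coe_univ, Set.inter_univ] at e
    rw [e]
  rw [prodBernoulli_real_gate_split q r, prodBernoulli_real_update_one_eq hdet q (Finset.mem_univ r),
    prodBernoulli_real_update_zero_eq hdet q (Finset.mem_univ r)]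
  -- `r` open: the count with `r` erased
  have hopen : {ω : Set E | insert r ω ∈ {ω' : Set E | Nc[A, P, ω'] = h}} = {ω : Set E | Nc[A, (fun y => (P y).erase r), ω] = h} := by
    ext ω
    simp only [Set.mem_setOf_eq]
    suffices e : Nc[A, P, insert r ω] = Nc[A, (fun y => (P y).erase r), ω] by rw [e]
    congr 1
    refine Finset.filter_congr fun a _ => ?_
    rw [Finset.coe_erase, Set.sdiff_singleton_subset_iff]
  -- `r` closed: nothing is reached
  have hclosed : {ω : Set E | ω \ {r} ∈ {ω' : Set E | Nc[A, P, ω'] = h}} = {ω : Set E | 0 = h} := by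
    ext ω
    simp only [Set.mem_setOf_eq]
    suffices e : Nc[A, P, ω \ {r}] = 0 by rw [e]
    rw [Finset.card_eq_zero, Finset.filter_eq_empty_iff]
    intro a ha hsub
    exact (hsub (Finset.mem_coe.2 (hr a ha))).2 rfl
  rw [hopen, hclosed]
  simp only [LawDec.gate]
  by_cases h0 : h = 0
  · subst h0
    have : {ω : Set E | (0 : ℕ) = 0} = Set.univ := by ext; simp
    rw [this, probReal_univ, if_pos rfl]; ring
  · have : {ω : Set E | (0 : ℕ) = h} = ∅ := by ext ω; simpa using fun e => h0 e.symm
    rw [this, measureReal_empty, if_neg h0]; ring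

omit [Fintype E] in
/-- **Point law.**  If no relay of `A` needs a gate (`P a = ∅` on `A`), the count is surely `#A`:
`P(N = h) = [h = #A]`. [this work] -/
theorem real_count_eq_point (q : E → unitInterval) (A : Finset E) (P : E → Finset E) (hP : ∀ a ∈ A, P a = ∅) (h : ℕ) :
    (prodBernoulli q).real {ω : Set E | Nc[A, P, ω] = h} = if h = A.card then 1 else 0 := by
  have hN : ∀ ω : Set E, Nc[A, P, ω] = A.card := by
    intro ω
    rw [Finset.filter_true_of_mem]
    intro a ha
    rw [hP a ha]
    simp
  simp_rw [hN]
  by_cases hh : h = A.card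
  · rw [if_pos hh]
    have : {ω : Set E | A.card = h} = Set.univ := by
      ext ω; simp [hh]
    rw [this, probReal_univ]
  · rw [if_neg hh]
    have : {ω : Set E | A.card = h} = ∅ := by ext ω; simpa using fun e => hh e.symm
    rw [this, measureReal_empty]

/-! ### 2. Root gates (only transitivity and comparability of the ancestor finsets are used; reflexivity is not needed,
which is what makes "erase a gate everywhere" an admissible move) -/

omit [Fintype E] in
/-- **A root gate exists.**  If some relay of `A` needs a gate, there is a needed gate `r` whose ancestor set has minimal size
among the needed gates and which is self-rooted (`r ∈ P r`) or free-standing (`P r = ∅`). [this work] -/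
theorem exists_root (P : E → Finset E) (htrans : ∀ x, ∀ y ∈ P x, P y ⊆ P x) (A : Finset E)
    (hU : (A.biUnion P).Nonempty) :
    ∃ r ∈ A.biUnion P, (∀ y ∈ A.biUnion P, (P r).card ≤ (P y).card) ∧ (r ∈ P r ∨ P r = ∅) := by
  obtain ⟨r₀, hr₀, hmin⟩ := Finset.exists_min_image (A.biUnion P) (fun y => (P y).card) hU
  by_cases h : r₀ ∈ P r₀ ∨ P r₀ = ∅
  · exact ⟨r₀, hr₀, hmin, h⟩
  · obtain ⟨-, hne⟩ := not_or.1 h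
    obtain ⟨y, hy⟩ := Finset.nonempty_iff_ne_empty.2 hne
    obtain ⟨a, ha, hra⟩ := Finset.mem_biUnion.1 hr₀
    have hyU : y ∈ A.biUnion P := Finset.mem_biUnion.2 ⟨a, ha, htrans a r₀ hra hy⟩
    have heq : P y = P r₀ := Finset.eq_of_subset_of_card_le (htrans r₀ y hy) (hmin y hyU)
    exact ⟨y, hyU, fun z hz => heq ▸ hmin z hz, Or.inl (heq ▸ hy)⟩

omit [Fintype E] in
/-- **Key property of a root gate**: every needed gate in its ancestor set is glued to it. [this work] -/
theorem root_mem_of_mem (P : E → Finset E) (htrans : ∀ x, ∀ y ∈ P x, P y ⊆ P x) (A : Finset E) {r : E}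
    (hmin : ∀ y ∈ A.biUnion P, (P r).card ≤ (P y).card) (hroot : r ∈ P r ∨ P r = ∅) {y : E}
    (hyU : y ∈ A.biUnion P) (hy : y ∈ P r) : r ∈ P y := by
  rcases hroot with hrr | hempty
  · rw [Finset.eq_of_subset_of_card_le (htrans r y hy) (hmin y hyU)]; exact hrr
  · exact absurd (hempty ▸ hy) (Finset.notMem_empty y)

omit [Fintype E] in
/-- **The tree of a root gate reads its own gates**: the relays needing `r` and the relays not needing `r` have disjoint
ancestor sets. [this work] -/
theorem disjoint_biUnion_root (P : E → Finset E) (htrans : ∀ x, ∀ y ∈ P x, P y ⊆ P x)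
    (hchain : ∀ x, ∀ y ∈ P x, ∀ z ∈ P x, y ∈ P z ∨ z ∈ P y) (A : Finset E) (r : E)
    (hkey : ∀ y ∈ A.biUnion P, y ∈ P r → r ∈ P y) :
    Disjoint ((A.filter fun a => r ∈ P a).biUnion P) ((A.filter fun a => ¬ r ∈ P a).biUnion P) := by
  rw [Finset.disjoint_left]
  intro y hy1 hy2
  obtain ⟨a, ha, hya⟩ := Finset.mem_biUnion.1 hy1
  obtain ⟨b, hb, hyb⟩ := Finset.mem_biUnion.1 hy2
  rw [Finset.mem_filter] at ha hb
  refine hb.2 (htrans b y hyb ?_)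
  rcases hchain a r ha.2 y hya with h | h
  · exact h
  · exact hkey y (Finset.mem_biUnion.2 ⟨b, hb.1, hyb⟩) h

/-! ### 3. The reached-relay count of a forest is TREE-BUILT at every floor below its marginals -/

omit [Fintype E] in
/-- The point case packaged: no needed gate ⟹ `TreeBuilt x #A (law)` (`δ_{#A}`). [this work] -/
theorem treeBuilt_of_forall_empty (q : E → unitInterval) (A : Finset E) (P : E → Finset E) (hP : ∀ a ∈ A, P a = ∅)
    (x : ℝ) (hx0 : 0 < x) (hx1 : x < 1) :
    LawDec.TreeBuilt x A.card (fun h => (prodBernoulli q).real {ω : Set E | Nc[A, P, ω] = h}) := by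
  have e : (fun h => (prodBernoulli q).real {ω : Set E | Nc[A, P, ω] = h}) = fun h => if h = A.card then (1 : ℝ) else 0 :=
    funext fun h => real_count_eq_point q A P hP h
  rw [e]
  exact LawDec.treeBuilt_point x hx0 hx1 A.card

omit [Fintype E] in
/-- A product of gate values over a finset containing `r` is at most `q r`. [folklore] -/
theorem prod_coe_le_apply (q : E → unitInterval) {S : Finset E} {r : E} (hr : r ∈ S) :
    ∏ y ∈ S, (q y : ℝ) ≤ q r := by
  rw [← Finset.mul_prod_erase S (fun y => (q y : ℝ)) hr]
  have h1 : ∏ y ∈ S.erase r, (q y : ℝ) ≤ 1 := Finset.prod_le_one (fun y _ => (q y).2.1) (fun y _ => (q y).2.2)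
  nlinarith [(q r).2.1]

/-- **THE BRIDGE LEMMA (induction).**  For ancestor finsets `P` that are transitive (`y ∈ P x → P y ⊆ P x`) and comparable
(`y, z ∈ P x → y ∈ P z ∨ z ∈ P y`), every relay set `A` and every floor `0 < x < 1` strictly below all marginals
`∏_{y ∈ P a} q y` (`a ∈ A`), the law of `N_A = #{a ∈ A : P a ⊆ ω}` under `prodBernoulli q` is `LawDec.TreeBuilt x #A`.
Induction on `#(⋃_A P a) + #A`: no needed gate ⟹ point law; else a root gate `r` — if every relay needs `r`, GATE (erase `r`,
floor `x / q r`), otherwise CONVOLUTION of the tree of `r` with the rest. [this work] -/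
theorem treeBuilt_real_count (q : E → unitInterval) :
    ∀ (n : ℕ) (P : E → Finset E) (A : Finset E), (A.biUnion P).card + A.card ≤ n →
      (∀ x, ∀ y ∈ P x, P y ⊆ P x) → (∀ x, ∀ y ∈ P x, ∀ z ∈ P x, y ∈ P z ∨ z ∈ P y) →
      ∀ x : ℝ, 0 < x → x < 1 → (∀ a ∈ A, x < ∏ y ∈ P a, (q y : ℝ)) →
      LawDec.TreeBuilt x A.card (fun h => (prodBernoulli q).real {ω : Set E | Nc[A, P, ω] = h}) := by
  intro n
  induction n with
  | zero =>
    intro P A hcard _ _ x hx0 hx1 _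
    have hA : A = ∅ := Finset.card_eq_zero.1 (by omega)
    subst hA
    exact treeBuilt_of_forall_empty q ∅ P (fun a ha => absurd ha (Finset.notMem_empty a)) x hx0 hx1
  | succ n ih =>
    intro P A hcard htrans hchain x hx0 hx1 hfloor
    by_cases hU : A.biUnion P = ∅
    · -- no gate is needed: point law
      refine treeBuilt_of_forall_empty q A P (fun a ha => ?_) x hx0 hx1
      exact Finset.subset_empty.1 (hU ▸ Finset.subset_biUnion_of_mem P ha)
    · obtain ⟨r, hrU, hmin, hroot⟩ := exists_root P htrans A (Finset.nonempty_iff_ne_empty.2 hU)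
      have hkey : ∀ y ∈ A.biUnion P, y ∈ P r → r ∈ P y :=
        fun y hyU hy => root_mem_of_mem P htrans A hmin hroot hyU hy
      obtain ⟨a₀, ha₀, hra₀⟩ := Finset.mem_biUnion.1 hrU
      -- the root gate is charged: `x < marginal ≤ q r`
      have hqr : (0 : ℝ) < q r := hx0.trans ((hfloor a₀ ha₀).trans_le (prod_coe_le_apply q hra₀))
      by_cases hall : ∀ a ∈ A, r ∈ P a
      · -- GATE: every relay needs `r`; erase it everywhere
        have htrans' : ∀ x, ∀ y ∈ (P x).erase r, (P y).erase r ⊆ (P x).erase r := by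
          intro x y hy
          exact Finset.erase_subset_erase r (htrans x y (Finset.mem_of_mem_erase hy))
        have hchain' : ∀ x, ∀ y ∈ (P x).erase r, ∀ z ∈ (P x).erase r, y ∈ (P z).erase r ∨ z ∈ (P y).erase r := by
          intro x y hy z hz
          rcases hchain x y (Finset.mem_of_mem_erase hy) z (Finset.mem_of_mem_erase hz) with h | h
          · exact Or.inl (Finset.mem_erase.2 ⟨Finset.ne_of_mem_erase hy, h⟩)
          · exact Or.inr (Finset.mem_erase.2 ⟨Finset.ne_of_mem_erase hz, h⟩)
        have hsub : A.biUnion (fun y => (P y).erase r) ⊆ (A.biUnion P).erase r := by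
          intro y hy
          obtain ⟨a, ha, hya⟩ := Finset.mem_biUnion.1 hy
          exact Finset.mem_erase.2 ⟨Finset.ne_of_mem_erase hya, Finset.mem_biUnion.2 ⟨a, ha, Finset.mem_of_mem_erase hya⟩⟩
        have hcard' : (A.biUnion (fun y => (P y).erase r)).card + A.card ≤ n := by
          have h1 := Finset.card_le_card hsub
          rw [Finset.card_erase_of_mem hrU] at h1
          have h2 : 0 < (A.biUnion P).card := Finset.card_pos.2 ⟨r, hrU⟩
          omega
        have hfloor' : ∀ a ∈ A, x / q r < ∏ y ∈ (P a).erase r, (q y : ℝ) := by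
          intro a ha
          have := hfloor a ha
          rw [← Finset.mul_prod_erase (P a) (fun y => (q y : ℝ)) (hall a ha)] at this
          rw [div_lt_iff₀ hqr, mul_comm]
          exact this
        have hx'1 : x / q r < 1 :=
          (hfloor' a₀ ha₀).trans_le (Finset.prod_le_one (fun y _ => (q y).2.1) (fun y _ => (q y).2.2))
        have hg := LawDec.TreeBuilt.gate (q r : ℝ) hqr (q r).2.2
          (ih (fun y => (P y).erase r) A hcard' htrans' hchain' (x / q r) (div_pos hx0 hqr) hx'1 hfloor')
        have e1 : (q r : ℝ) * (x / q r) = x := by field_simp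
        have e2 : LawDec.gate (fun i => (prodBernoulli q).real {ω : Set E | Nc[A, (fun y => (P y).erase r), ω] = i}) (q r) =
            fun h => (prodBernoulli q).real {ω : Set E | Nc[A, P, ω] = h} :=
          funext fun h => (real_count_eq_gate q A P r hall h).symm
        rw [e1, e2] at hg; exact hg
      · -- CONVOLUTION: the tree of `r` and the rest
        obtain ⟨b₀, hb₀, hrb₀⟩ : ∃ b ∈ A, ¬ r ∈ P b := by
          by_contra hcon
          exact hall fun a ha => by_contra fun hra => hcon ⟨a, ha, hra⟩
        have hc1 : (A.filter fun a => r ∈ P a).card < A.card :=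
          Finset.card_lt_card (Finset.filter_ssubset.2 ⟨b₀, hb₀, hrb₀⟩)
        have hc2 : (A.filter fun a => ¬ r ∈ P a).card < A.card :=
          Finset.card_lt_card (Finset.filter_ssubset.2 ⟨a₀, ha₀, not_not.2 hra₀⟩)
        have hu1 : ((A.filter fun a => r ∈ P a).biUnion P).card ≤ (A.biUnion P).card :=
          Finset.card_le_card (Finset.biUnion_subset_biUnion_of_subset_left P (Finset.filter_subset _ A))
        have hu2 : ((A.filter fun a => ¬ r ∈ P a).biUnion P).card ≤ (A.biUnion P).card :=
          Finset.card_le_card (Finset.biUnion_subset_biUnion_of_subset_left P (Finset.filter_subset _ A))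
        have ih₁ := ih P (A.filter fun a => r ∈ P a) (by omega) htrans hchain x hx0 hx1
          (fun a ha => hfloor a (Finset.mem_filter.1 ha).1)
        have ih₂ := ih P (A.filter fun a => ¬ r ∈ P a) (by omega) htrans hchain x hx0 hx1
          (fun a ha => hfloor a (Finset.mem_filter.1 ha).1)
        have hc := LawDec.TreeBuilt.conv ih₁ ih₂
        have e1 : (A.filter fun a => r ∈ P a).card + (A.filter fun a => ¬ r ∈ P a).card = A.card :=
          Finset.card_filter_add_card_filter_not _
        have e2 : LawDec.lconv (A.filter fun a => r ∈ P a).card (A.filter fun a => ¬ r ∈ P a).card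
            (fun i => (prodBernoulli q).real {ω : Set E | Nc[A.filter (fun a => r ∈ P a), P, ω] = i})
            (fun i => (prodBernoulli q).real {ω : Set E | Nc[A.filter (fun a => ¬ r ∈ P a), P, ω] = i}) =
            fun h => (prodBernoulli q).real {ω : Set E | Nc[A, P, ω] = h} :=
          funext fun h => (real_count_eq_lconv q A P r (disjoint_biUnion_root P htrans hchain A r hkey) h).symm
        rw [e1, e2] at hc; exact hc

/-- **The reached-relay count of a rooted forest is tree-built** (the form used below): ancestor finsets `P` transitive and
comparable, floor `0 < x < 1` with `x < ∏_{y ∈ P a} q y` for every `a ∈ A` ⟹ `LawDec.TreeBuilt x #A (law of N_A)`. [this work] -/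
theorem treeBuilt_law (q : E → unitInterval) (P : E → Finset E) (htrans : ∀ x, ∀ y ∈ P x, P y ⊆ P x)
    (hchain : ∀ x, ∀ y ∈ P x, ∀ z ∈ P x, y ∈ P z ∨ z ∈ P y) (A : Finset E) (x : ℝ) (hx0 : 0 < x) (hx1 : x < 1)
    (hfloor : ∀ a ∈ A, x < ∏ y ∈ P a, (q y : ℝ)) :
    LawDec.TreeBuilt x A.card (fun h => (prodBernoulli q).real {ω : Set E | Nc[A, P, ω] = h}) :=
  treeBuilt_real_count q _ P A le_rfl htrans hchain x hx0 hx1 hfloor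

end ForestLaw

end Quant

end Summit.CriticalPhenomena.PercolationContinuityZ3.Theorems
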